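import Mathlib.Analysis.Distribution.SchwartzSpace.Basic
import Mathlib.Analysis.Calculus.Taylor
import HarnessLib

/-!
# Taylor polynomials of translates of a Schwartz function, with a remainder that decays in the translate:
# `‖g(u+v) − Σ_{l≤d} g^{(l)}(x₀+v)(u−x₀)^l/l!‖ ≤ C_{d,N} h^{d+1}(1+v)^{−N}` (`x₀ ≤ u ≤ x₀+h`, `x₀, v ≥ 0`)

RH-FREE real analysis (cell `rh-crit`, sub-cell cc, seat t13; serves ONLY the planned discharge of the tree fact
`CC2021_lemma_D47` — Connes–Consani 2021 App. D Lemma D.1 (47) "`[H, f]` is an infinitesimal of infinite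
order" — through the separable (finite-rank) approximation of the Fourier-side kernel `(sgn ξ − sgn η)f̂(ξ−η)`
on the off-diagonal quadrants, where it is `(u, v) ↦ f̂(±(u + v))`, `u, v ≥ 0`: Taylor expansion in `u` on
boxes of side `h` gives separable terms `(u−x₀)^l ⊗ f̂^{(l)}(x₀+v)` and a remainder that is small in `h` AND
rapidly decaying in `v`, which is what makes the Hilbert–Schmidt error `O(n^{−k})` for every `k`;
App. D p. 33, arXiv chunk p0033:L24–36 / Rem. 48 L39–41).  WHAT THIS IS NOT: any claim about RH.
Theorems only; no definition, no named fact (net debt 0).  Ingredients: Mathlib's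
`taylor_mean_remainder_bound` and the Schwartz seminorm bound `SchwartzMap.one_add_le_sup_seminorm_apply`.
-/

noncomputable section

open Set
open scoped Nat Pointwise

namespace Literature.Analysis.Calculus

/-- RH-FREE. The iterated derivative of a translate: `(g(· + v))^{(n)}(x) = g^{(n)}(x + v)`. [folklore] -/
private theorem iteratedDeriv_translate (g : ℝ → ℂ) (n : ℕ) (v x : ℝ) :
    iteratedDeriv n (fun z => g (z + v)) x = iteratedDeriv n g (x + v) := by
  have h := congrFun (iteratedDerivWithin_comp_add_const (n := n) (f := g) (s := (univ : Set ℝ)) v) x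
  simp only [iteratedDerivWithin_univ] at h
  rw [h, Set.vadd_set_univ, iteratedDerivWithin_univ]

/-- RH-FREE. **Uniform decay of the derivatives of a Schwartz function**: `‖g^{(n)}(w)‖(1+|w|)^N ≤ M_{N,n}`.
[cite: ConnesConsani2021, App. D p. 33 (arXiv chunk p0033:L24–36: "`f ∈ 𝒮`", smoothness and rapid decay)] -/
theorem SchwartzMap.norm_iteratedDeriv_le_inv_one_add_pow (g : SchwartzMap ℝ ℂ) (N n : ℕ) :
    ∃ M : ℝ, 0 ≤ M ∧ ∀ w : ℝ, ‖iteratedDeriv n g w‖ ≤ M * ((1 + |w|) ^ N)⁻¹ := by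
  refine ⟨2 ^ N * (Finset.Iic (N, n)).sup (fun m => SchwartzMap.seminorm ℝ m.1 m.2) g,
    by positivity, fun w => ?_⟩
  have h := SchwartzMap.one_add_le_sup_seminorm_apply (𝕜 := ℝ) (m := (N, n)) le_rfl le_rfl g w
  rw [norm_iteratedFDeriv_eq_norm_iteratedDeriv, Real.norm_eq_abs] at h
  have hpos : 0 < (1 + |w|) ^ N := by positivity
  rw [← div_eq_mul_inv, le_div_iff₀ hpos, mul_comm]
  exact h

/-- RH-FREE. **Taylor expansion of the translates of a Schwartz function, remainder decaying in the
translate**: for `d, N` there is `C` with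
`‖g(u+v) − Σ_{l≤d} (l!)⁻¹(u−x₀)^l g^{(l)}(x₀+v)‖ ≤ C·h^{d+1}·(1+v)^{−N}` whenever `0 ≤ x₀ ≤ u ≤ x₀ + h` and
`v ≥ 0` (Taylor's theorem on `[x₀, x₀+h]` for `u ↦ g(u+v)`, whose `(d+1)`-st derivative `g^{(d+1)}(·+v)` is
bounded there by `M(1+v)^{−N}`).  The separable terms `(u−x₀)^l ⊗ g^{(l)}(x₀+·)` are the finite-rank pieces of
the kernel `g(u+v)` on `[x₀, x₀+h] × [0, ∞)`.
[cite: ConnesConsani2021, App. D Lemma 47 proof p. 33 (arXiv chunk p0033:L24–36) and Rem. 48 (chunk p0033:L39–41)] -/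
theorem SchwartzMap.norm_sub_taylor_translate_le (g : SchwartzMap ℝ ℂ) (d N : ℕ) :
    ∃ C : ℝ, 0 ≤ C ∧ ∀ (x₀ h u v : ℝ), 0 ≤ x₀ → 0 < h → u ∈ Icc x₀ (x₀ + h) → 0 ≤ v →
      ‖g (u + v) - ∑ l ∈ Finset.range (d + 1),
          (((l ! : ℝ)⁻¹ * (u - x₀) ^ l : ℝ)) • iteratedDeriv l g (x₀ + v)‖
        ≤ C * h ^ (d + 1) * ((1 + v) ^ N)⁻¹ := by
  obtain ⟨M, hM0, hM⟩ := SchwartzMap.norm_iteratedDeriv_le_inv_one_add_pow g N (d + 1)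
  refine ⟨M / d !, by positivity, fun x₀ h u v hx₀ hh hu hv => ?_⟩
  -- the translate and its regularity on `[x₀, x₀ + h]`
  set f : ℝ → ℂ := fun z => g (z + v) with hf
  have hsmooth : ContDiff ℝ ((d + 1 : ℕ) : ℕ∞) f :=
    (g.smooth ((d + 1 : ℕ) : ℕ∞)).comp ((contDiff_id (𝕜 := ℝ)).add (contDiff_const (c := v)))
  have hfd : ContDiffOn ℝ (d + 1) f (Icc x₀ (x₀ + h)) := by
    have := hsmooth.contDiffOn (s := Icc x₀ (x₀ + h))
    exact_mod_cast this
  have hU : UniqueDiffOn ℝ (Icc x₀ (x₀ + h)) := uniqueDiffOn_Icc (by linarith)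
  -- within = global derivatives, and translation
  have hwithin : ∀ (l : ℕ) (y : ℝ), y ∈ Icc x₀ (x₀ + h) →
      iteratedDerivWithin l f (Icc x₀ (x₀ + h)) y = iteratedDeriv l g (y + v) := by
    intro l y hy
    have hlc : ContDiffAt ℝ (l : ℕ∞) f y :=
      ((g.smooth (l : ℕ∞)).comp ((contDiff_id (𝕜 := ℝ)).add (contDiff_const (c := v)))).contDiffAt
    rw [iteratedDerivWithin_eq_iteratedDeriv hU (by exact_mod_cast hlc) hy, hf, iteratedDeriv_translate]
  -- the bound on the `(d+1)`-st derivative on the interval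
  have hC : ∀ y ∈ Icc x₀ (x₀ + h),
      ‖iteratedDerivWithin (d + 1) f (Icc x₀ (x₀ + h)) y‖ ≤ M * ((1 + v) ^ N)⁻¹ := by
    intro y hy
    rw [hwithin (d + 1) y hy]
    refine (hM (y + v)).trans ?_
    have hyv : v ≤ |y + v| := by
      rw [abs_of_nonneg (by linarith [hy.1])]; linarith [hy.1]
    gcongr
  -- Taylor's theorem
  have htaylor := taylor_mean_remainder_bound (f := f) (n := d) (by linarith : x₀ ≤ x₀ + h) hfd hu hC
  have hpoly : taylorWithinEval f d (Icc x₀ (x₀ + h)) x₀ u =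
      ∑ l ∈ Finset.range (d + 1), (((l ! : ℝ)⁻¹ * (u - x₀) ^ l : ℝ)) • iteratedDeriv l g (x₀ + v) := by
    rw [taylor_within_apply]
    refine Finset.sum_congr rfl fun l _ => ?_
    rw [hwithin l x₀ (left_mem_Icc.2 (by linarith))]
  have hfu : f u = g (u + v) := rfl
  rw [hpoly, hfu] at htaylor
  refine htaylor.trans ?_
  have hux : u - x₀ ≤ h := by linarith [hu.2]
  have hux0 : 0 ≤ u - x₀ := by linarith [hu.1]
  have hpow : (u - x₀) ^ (d + 1) ≤ h ^ (d + 1) := pow_le_pow_left₀ hux0 hux _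
  have hfac : (0 : ℝ) < d ! := by positivity
  rw [div_le_iff₀ hfac] at *
  calc M * ((1 + v) ^ N)⁻¹ * (u - x₀) ^ (d + 1)
      ≤ M * ((1 + v) ^ N)⁻¹ * h ^ (d + 1) := by gcongr
    _ = M / d ! * h ^ (d + 1) * ((1 + v) ^ N)⁻¹ * d ! := by field_simp

end Literature.Analysis.Calculus
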